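import Summits.AnomalousDissipation.AnomalousDissipation.Theorems.SolenoidalFractalHomogenisationLagrangianStepVmodDistortedTestPairingClass
import Literature.Analysis.FluidPDE.PassiveVectorTensorDistortedFrameTest
import Literature.Analysis.FluidPDE.PassiveVectorTensorDistortedFramePairing
import HarnessLib

/-!
# K1L_D (stmt-AnomalousDissipation-27980), (ℓ3-A) road A: (D-GEN-J) — a distorted propagator tested against a CO-MOVING CORRECTED steady
# solenoidal test `J(t)•ζ₀` (`G J = 1`), from the frame reset
(helper; `--supports 27980 --as helper`; prover ad-k1loc-p3 g11; the first APPLICATION of (D-GEN) p722918/p723523: the admissible family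
«co-moving corrected modes `η(τ)·J(τ)φ_k`» of memo L22 §3 / `…DistortedFramePairing`, here at propagator level and for a STEADY flat test.)

CONVENTION (D28-8′): derivative-index distortion `Torus.Visc4.conj`; constraint `∇·(G v) = 0` (`Torus.distort`).

For a distorted propagator `IsDistortedPropagator Tw 𝔸 b G U` over a frame modulation `IsFrameModulation θ Tw nC G`, the v2 clause `hsol` (L22 §4
bytes), a pointwise INVERSE FRAME `J` (`G t y * J t y = 1`) with the regularity the distorted test class demands — smooth slices, ALL iterated
`y`-derivatives of the entries jointly continuous on `ℝ × 𝕋³` (FLAG F-p3g11-1: not supplied by `IsFrameModulation`; free for the instance from the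
FR package), entries Lipschitz in `t` on `[0,Tw]` uniformly in `y`, and an a.e.-in-time entrywise derivative `J'` (same null set for all `y`) — and
a smooth flat-solenoidal STEADY test `ζ₀`:
* `correctedTest_isDivFree` — `∇·(G(t) (J(t)•ζ₀)) = 0` (`distort_distort_of_mul_eq_one`); `correctedTest_zero` — `J(0)•ζ₀ = ζ₀` (`G 0 = 1`);
* `correctedTest_lipschitz` — `J•ζ₀` is Lipschitz in time on `[0,Tw]` uniformly in space (FT3 `exists_lipschitz_distort`);
* `correctedTest_hasDerivAt` — `∂_t (J•ζ₀) = J'•ζ₀` a.e. in `t`, every `y` (`hasDerivAt_distort`);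
* **`IsDistortedPropagator.abs_inner_sub_inner_le_of_correctedTest`** —
  `|⟪U 0 t y, J(t)•ζ₀⟫ − ⟪y, ζ₀⟫| ≤ t · N · ‖y‖`  for every `t ∈ [0,Tw]`, `y ∈ V2`,
  whenever `N ≥ ‖J'•ζ₀ + (b·∇)(J•ζ₀) + 𝓛^{G,*}_𝔸 (J•ζ₀)‖_{L²}` for a.e. `τ ∈ (0,Tw)` (admissibility FT1–FT3 of `…DistortedFrameTest` +
  `abs_inner_sub_inner_le_of_lipschitzTest_frameClass`).  The size of `N` (sup norms of `J, ∂J, ∂²J, J'`, `‖b‖_∞`, the `C²` data of `ζ₀`) is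
  NOT computed here — it is the block prover's accounting.
`sorry`-free; NOT a proof of any block, of (M_θ), of `stub_Vmod_EHTthg`, of K1L_D or of AD; rung F-D1.A0.
-/

set_option linter.dupNamespace false

noncomputable section

namespace Summit.AnomalousDissipation.AnomalousDissipation.Theorems.SolenoidalFractalHomogenisation.LagrangianStep.CellClauseMod

open Literature.Analysis Literature.Analysis.FluidPDE Literature.Analysis.FunctionSpaces
open MeasureTheory Set Filter UnitAddTorus Function Topology
open scoped ENNReal NNReal InnerProductSpace

variable {Tw : ℝ} {𝔸 : Torus.Visc4 (Fin 3)} {b : ℝ → VF} {G J J' : ℝ → UnitAddTorus (Fin 3) → Matrix (Fin 3) (Fin 3) ℝ}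
  {U : ℝ → ℝ → (V2 →L[ℝ] V2)} {ζ₀ : VF}

/-! ## §1 The corrected steady test `J(t)•ζ₀` -/

/-- The corrected test satisfies the distorted constraint: `G•(J•ζ₀) = ζ₀` is divergence free. -/
theorem correctedTest_isDivFree (hGJ : ∀ t y, G t y * J t y = 1) (hζdiv : Torus.IsDivFree ζ₀) (t : ℝ) :
    Torus.IsDivFree (Torus.distort (G t) (Torus.distort (J t) ζ₀)) := by
  rw [Torus.distort_distort_of_mul_eq_one (hGJ t)]; exact hζdiv

/-- At the reset the inverse frame is the identity, `J 0 = 1` (`G 0 = 1`, `G J = 1`). -/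
theorem inverseFrame_zero (hG0 : ∀ y, G 0 y = 1) (hGJ : ∀ t y, G t y * J t y = 1) (y : UnitAddTorus (Fin 3)) : J 0 y = 1 := by
  have h := hGJ 0 y
  rwa [hG0 y, Matrix.one_mul] at h

/-- At the reset the corrected test is the flat test: `J(0)•ζ₀ = ζ₀`. -/
theorem correctedTest_zero (hG0 : ∀ y, G 0 y = 1) (hGJ : ∀ t y, G t y * J t y = 1) : Torus.distort (J 0) ζ₀ = ζ₀ := by
  rw [show J 0 = fun _ => (1 : Matrix (Fin 3) (Fin 3) ℝ) from funext (inverseFrame_zero hG0 hGJ), Torus.distort_one]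

/-- Entries of `J` are bounded on `[0,T] × 𝕋³` when all their iterated `y`-derivatives are jointly continuous (order `0` suffices). -/
theorem exists_bound_inverseFrame
    (hJc : ∀ (l : List (Fin 3)) (a c : Fin 3), Continuous (uncurry fun t y => Torus.iterPartialDeriv l (fun y => J t y a c) y)) (T : ℝ) :
    ∃ B : ℝ, ∀ t ∈ Icc 0 T, ∀ y a c, |J t y a c| ≤ B := by
  have hJ0 : ∀ a c, Continuous (uncurry fun t y => J t y a c) := fun a c => by simpa using hJc [] a c
  obtain ⟨C, _, hC⟩ := exists_bound_entries (G := J) hJ0 T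
  exact ⟨C, hC⟩

/-- The corrected steady test is Lipschitz in time on `[0,Tw]`, uniformly in space (FT3). -/
theorem correctedTest_lipschitz (hζs : Torus.IsSmooth ζ₀)
    (hJc : ∀ (l : List (Fin 3)) (a c : Fin 3), Continuous (uncurry fun t y => Torus.iterPartialDeriv l (fun y => J t y a c) y))
    (hJL : ∃ K : ℝ, ∀ t ∈ Icc 0 Tw, ∀ s ∈ Icc 0 Tw, ∀ y a c, |J t y a c - J s y a c| ≤ K * |t - s|) :
    ∃ L : ℝ, 0 ≤ L ∧ ∀ t ∈ Icc 0 Tw, ∀ s ∈ Icc 0 Tw, ∀ y,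
      ‖Torus.distort (J t) ζ₀ y - Torus.distort (J s) ζ₀ y‖ ≤ L * |t - s| := by
  obtain ⟨B', hB'⟩ := isCompact_univ.exists_bound_of_continuousOn (hζs.continuous.continuousOn (s := univ))
  exact Torus.exists_lipschitz_distort (J := J) (φ := fun _ => ζ₀) hJL (exists_bound_inverseFrame hJc Tw)
    ⟨0, fun t _ s _ y => by simp⟩ ⟨B', fun t _ y => hB' y (mem_univ y)⟩

/-- The time derivative of the corrected steady test: `∂_t (J•ζ₀) = J'•ζ₀` wherever `J` is entrywise differentiable in `t` (every `y`). -/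
theorem correctedTest_hasDerivAt {t : ℝ} (hJ' : ∀ y, HasDerivAt (fun s => J s y) (J' t y) t) (y : UnitAddTorus (Fin 3)) :
    HasDerivAt (fun s => Torus.distort (J s) ζ₀ y) (Torus.distort (J' t) ζ₀ y) t := by
  have h := Torus.hasDerivAt_distort (J := J) (φ := fun _ => ζ₀) (J' := J' t) (φ' := fun _ => 0) (hJ' y) (hasDerivAt_const t (ζ₀ y))
  have e0 : Torus.distort (J t) (fun _ => (0 : EuclideanSpace ℝ (Fin 3))) y = 0 := by
    simp [Torus.distort]
  simpa [e0] using h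

/-! ## §2 (D-GEN-J): the distorted propagator against a co-moving corrected steady test -/

set_option maxHeartbeats 800000 in
/-- **(D-GEN-J).**  See the module docstring.  [cite: DiPernaLions1989, §II.1 (12)–(14)] [cite: Temam1997, Ch. II §3.1–3.2, (3.2)–(3.5), Thm. 3.1] -/
theorem IsDistortedPropagator.abs_inner_sub_inner_le_of_correctedTest {θ nC : ℝ} (hU : IsDistortedPropagator Tw 𝔸 b G U)
    (hG : IsFrameModulation θ Tw nC G)
    (hsol : ∀ s, 0 ≤ s → s < Tw → ∀ (φ : VF) (hφ : MemLp φ 2 volume), Torus.IsWeaklyDivFree (Torus.distort (G s) φ) → ∃ w : ℝ → VF,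
      Torus.IsWeakTensorPassiveVectorDistortedOn 0 (Tw - s) 𝔸 (fun τ => b (s + τ)) (fun τ => G (s + τ)) φ w)
    (hGJ : ∀ t y, G t y * J t y = 1)
    (hJs : ∀ t a c, Torus.IsSmooth (fun y => J t y a c))
    (hJc : ∀ (l : List (Fin 3)) (a c : Fin 3), Continuous (uncurry fun t y => Torus.iterPartialDeriv l (fun y => J t y a c) y))
    (hJL : ∃ K : ℝ, ∀ t ∈ Icc 0 Tw, ∀ s ∈ Icc 0 Tw, ∀ y a c, |J t y a c - J s y a c| ≤ K * |t - s|)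
    (hJ' : ∀ᵐ t ∂(volume.restrict (Ioo 0 Tw)), ∀ y, HasDerivAt (fun s => J s y) (J' t y) t)
    (hζs : Torus.IsSmooth ζ₀) (hζdiv : Torus.IsDivFree ζ₀)
    {N : ℝ} (hN0 : 0 ≤ N)
    (hN : ∀ᵐ τ ∂(volume.restrict (Ioo 0 Tw)),
      MemLp (fun x => Torus.distort (J' τ) ζ₀ x + Torus.convect (b τ) (Torus.distort (J τ) ζ₀) x +
          Torus.viscAdjVar (fun y => Torus.Visc4.conj (G τ y) 𝔸) (Torus.distort (J τ) ζ₀) x) 2 volume ∧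
      eLpNorm (fun x => Torus.distort (J' τ) ζ₀ x + Torus.convect (b τ) (Torus.distort (J τ) ζ₀) x +
          Torus.viscAdjVar (fun y => Torus.Visc4.conj (G τ y) 𝔸) (Torus.distort (J τ) ζ₀) x) 2 volume ≤ ENNReal.ofReal N)
    {t : ℝ} (ht : t ∈ Icc 0 Tw) (y : V2) :
    |⟪U 0 t y, ((Torus.isSmooth_distort (hJs t) hζs).memLp 2).toLp (Torus.distort (J t) ζ₀)⟫_ℝ - ⟪y, (hζs.memLp 2).toLp ζ₀⟫_ℝ|
      ≤ t * N * ‖y‖ := by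
  -- admissibility of `ψ t := J t • ζ₀`
  set ψ : ℝ → VF := fun t => Torus.distort (J t) ζ₀ with hψdef
  have hψs : ∀ t, Torus.IsSmooth (ψ t) := fun t => Torus.isSmooth_distort (hJs t) hζs
  have hζc : ∀ l : List (Fin 3), Continuous (uncurry fun (_ : ℝ) y => Torus.iterPartialDeriv l ζ₀ y) :=
    fun l => (hζs.iterPartialDeriv l).continuous.comp continuous_snd
  have hψc : ∀ l : List (Fin 3), Continuous (uncurry fun t y => Torus.iterPartialDeriv l (ψ t) y) :=
    fun l => Torus.continuous_uncurry_iterPartialDeriv_distort (J := J) (φ := fun _ => ζ₀) hJs (fun _ => hζs) hJc hζc l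
  have hψL : ∃ L : ℝ, 0 ≤ L ∧ ∀ t ∈ Icc 0 Tw, ∀ s ∈ Icc 0 Tw, ∀ y, ‖ψ t y - ψ s y‖ ≤ L * |t - s| :=
    correctedTest_lipschitz hζs hJc hJL
  have hψdiv : ∀ t, Torus.IsDivFree (Torus.distort (G t) (ψ t)) := correctedTest_isDivFree hGJ hζdiv
  have hψ' : ∀ᵐ t ∂(volume.restrict (Ioo 0 Tw)), ∀ y, HasDerivAt (fun s => ψ s y) (Torus.distort (J' t) ζ₀ y) t := by
    filter_upwards [hJ'] with t ht y
    exact correctedTest_hasDerivAt ht y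
  have key := hU.abs_inner_sub_inner_le_of_lipschitzTest_frameClass hG hsol (ψ' := fun t y => Torus.distort (J' t) ζ₀ y)
    hψs hψc hψL hψdiv hψ' hN0 hN ht y
  -- the datum side: `ψ 0 = ζ₀`
  have e0 : ψ 0 = ζ₀ := correctedTest_zero hG.init hGJ
  have hL0 : ((hψs 0).memLp 2).toLp (ψ 0) = (hζs.memLp 2).toLp ζ₀ :=
    (MemLp.toLp_eq_toLp_iff _ _).2 (by rw [e0])
  rw [hL0] at key
  exact key

end Summit.AnomalousDissipation.AnomalousDissipation.Theorems.SolenoidalFractalHomogenisation.LagrangianStep.CellClauseMod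

end
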